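import Literature.Computability.Complexity.FoldBricks

/-!
# Crux `ArithStatLadder.IqThreeNotPPoly` (stmt-QuantumAdvantage-2422) — stub `stub_natAdapter`

Line `Sketch`, stub D (the `ℕ`-adapter guarding non-canonical numerals). A sampler `f ∈ FP` reads a
pair `⟨x, r⟩` whose first component `x` is meant to be the numeral `encodeNat m` of a modulus. The
one-sidedness of the randomized reduction must hold for EVERY first component `x`, including the
words that are no `encodeNat m` at all: Mathlib's `encodeNat m` is `[]` for `m = 0` and otherwise ends
in `true`, so exactly the nonempty words ending in `false` are outside the range of `encodeNat`
(`IsCanonicalNum`, `isCanonicalNum_encodeNat`, `encodeNat_decodeNat`).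

The adapter is `f' := iteFn (lastFalseF ∘ fstF) (fun _ => y₀) f`: the brick `Brick.lastFalseF` of
`FoldBricks.lean` is the one-bit `FP` test "nonempty and ending in `false`" (`lastFalseF_apply`), so
`f'` is in `FP` (`iteFn_mem_FP`), agrees with `f` on every `⟨encodeNat m, r⟩` (the test reads `[false]`
there), and is the constant `y₀` on every `⟨x, r⟩` with `x ∉ range encodeNat` (the test reads `[true]`
there, because such an `x` is not a canonical numeral).
-/

set_option linter.dupNamespace false -- D-0017: single-problem summit ⇒ `QuantumAdvantage.QuantumAdvantage` by design

namespace Summit.QuantumAdvantage.QuantumAdvantage.Theorems.IqThreeNotPPoly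

open _root_.Computability Literature.Computability.Complexity
open Literature.Computability.Complexity.Brick

/-- On a numeral `encodeNat m` the test "nonempty and ending in `false`" reads `[false]`. -/
theorem lastFalseF_encodeNat (m : ℕ) : lastFalseF (encodeNat m) = [false] := by
  rw [lastFalseF_apply]
  rcases isCanonicalNum_encodeNat m with h | h
  · rw [h]; rfl
  · rw [h]; rfl

/-- A word outside the range of `encodeNat` is nonempty and ends in `false`. -/
theorem getLast?_eq_some_false_of_forall_ne {x : List Bool} (hx : ∀ m : ℕ, encodeNat m ≠ x) :
    x.getLast? = some false := by
  have hnc : ¬ IsCanonicalNum x := fun h => hx (decodeNat x) (encodeNat_decodeNat h)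
  unfold IsCanonicalNum at hnc
  cases hb : x.getLast? with
  | none => exact absurd (Or.inl (List.getLast?_eq_none_iff.mp hb)) hnc
  | some b =>
    cases b with
    | false => rfl
    | true => exact absurd (Or.inr hb) hnc

/-- On a word outside the range of `encodeNat` the test "nonempty and ending in `false`" reads
`[true]`. -/
theorem lastFalseF_of_forall_ne {x : List Bool} (hx : ∀ m : ℕ, encodeNat m ≠ x) :
    lastFalseF x = [true] := by
  rw [lastFalseF_apply, getLast?_eq_some_false_of_forall_ne hx]; rfl

/-- **STUB D · `stub_natAdapter`.** Every `f ∈ FP` and default answer `y₀` admit an `f' ∈ FP` that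
agrees with `f` on all pairs `⟨encodeNat m, r⟩` and is constantly `y₀` on all pairs `⟨x, r⟩` whose
first component `x` is no `encodeNat m`: `f' := iteFn (lastFalseF ∘ fstF) (fun _ => y₀) f`. -/
theorem stub_natAdapter :
    ∀ (f : List Bool → List Bool), f ∈ FP → ∀ y₀ : List Bool,
      ∃ f' : List Bool → List Bool, f' ∈ FP ∧
        (∀ (m : ℕ) (r : List Bool), f' (boolPair (encodeNat m) r) = f (boolPair (encodeNat m) r)) ∧
        (∀ (x r : List Bool), (∀ m : ℕ, encodeNat m ≠ x) → f' (boolPair x r) = y₀) := by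
  intro f hf y₀
  refine ⟨iteFn (lastFalseF ∘ fstF) (fun _ => y₀) f, ?_, ?_, ?_⟩
  · exact iteFn_mem_FP (comp_mem_FP lastFalseF_mem_FP fstF_mem_FP) (const_mem_FP _) hf
  · intro m r
    exact iteFn_apply_false (by rw [Function.comp_apply, fstF_boolPair, lastFalseF_encodeNat])
  · intro x r hx
    exact iteFn_apply_true (by rw [Function.comp_apply, fstF_boolPair, lastFalseF_of_forall_ne hx])

end Summit.QuantumAdvantage.QuantumAdvantage.Theorems.IqThreeNotPPoly
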